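import Literature.IUT.HodgeTheaters.StableCurveTemperedDataOfSpecialFibreTowerLemmas
import Literature.AnabelianGeometry.SemiGraphs.TemperedSpecialFibreTowerPiData
import Literature.AnabelianGeometry.SemiGraphs.TemperedCompactInVerticialFinite
import HarnessLib

/-!
# [IUTchI] Prop. 2.4 (i) at the genuine 𝔛-data over the `Π`-data record of the special-fibre tower

Mochizuki, *Inter-universal Teichmüller theory I*, kurims manuscript (May 2020), §2, Prop. 2.4 (i) and its proof
p. 50 [cite: Mochizuki2012, Prop 2.4(i) p.50] (D-0012 claim key; nothing of the series is asserted here), over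
Mochizuki, *Semi-graphs of anabelioids*, Publ. RIMS **42** (2006), Ex. 3.10 p. 44 and Thm. 3.7 (iii) p. 41
[cite: MochizukiSemiAnbd2006, Ex 3.10 p.44; Thm 3.7(iii) p.41].

PROOF-ONLY assembly (abc-iut-L5-t11; no definitions).  abc-iut-L3-t2's `SpecialFibreTower.PiData X d S T`
(`TemperedSpecialFibreTowerPiData.lean`: the cofinality of the levels `N_cofinal` — GAP-LEDGER G-L5t11g6-1 CLOSED —
and the finiteness of the special fibres `finite : FiniteLevels`) discharges two binders of the Prop. 2.4 (i) tower
files at the genuine 𝔛-datum `StableCurveTemperedData.ofSpecialFibre X d S …`: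
* `hcof := P.N_cofinal`;
* `hCV i : CompactInVerticialAt (T.Gc i) :=` [SemiAnbd] Thm. 3.7 (iii) AT the FINITE level fibre — a THEOREM of the
  tree (`ProfiniteSemiGraph.compactInVerticialAt_of_finiteGraph'`, abc-iut-L3-t8), from `P.finite`.
Capstones: `prop24i_ofSpecialFibre_of_finiteLevels` (hcof explicit, `FiniteLevels` only) and
`prop24i_ofSpecialFibre_of_piData` (the (INV) input kept as `DetectsTempered`; for (INV) reduced to the tempered
completeness `hlim` + `hNinj`, supply `hINV := detectsTempered_ofSpecialFibre … P.N_cofinal hNinj hlim` from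
`StableCurveTemperedDataOfSpecialFibreTowerKernel.lean`).  What remains named at the genuine datum: the per-level node
data with (A3) ([NodNon] Lem. 1.9 (ii)), "[Config] Rmk 1.2.2" (`StronglyTorsionFreeSigma`), the `p ∉ Σ` specialisation
half (`SpecializationAb`), and (INV).  Typed ≠ discharged for those; nothing here bears on [IUTchIII] Cor. 3.12.
-/

noncomputable section

namespace Literature.IUT.HodgeTheaters

open _root_.Topology Pointwise
open Literature.AnabelianGeometry.SemiGraphs Literature.AnabelianGeometry.SemiGraphs.ProfiniteSemiGraph

namespace StableCurveTemperedData

namespace OfSpecialFibre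

variable {p : ℕ} [Fact p.Prime] (X : TemperedCurve p) (d : X.GroupLevelData)
  (T : SpecialFibreTower X.DeltaTemp)
  (Sigma SigmaHat : Set ℕ) (hsub : Sigma ⊆ SigmaHat) (hne : Set.Nonempty Sigma)
  (hprime : ∀ q ∈ SigmaHat, q.Prime)
  (S : SpecialFibreData (X.toTemperedArithmeticGroup d)) (h36 : S.Gc.Prop36Hypotheses)
  (hp : p ∉ Sigma) (TpH : Subgroup S.chart.G)
  (HatH : Subgroup (TemperedGraphGroupData.exists_completion_of_prop36 S.Gc h36 S.chart).choose)
  (hle : TpH.map (TemperedGraphGroupData.exists_completion_of_prop36 S.Gc h36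
    S.chart).choose_spec.choose.toMonoidHom ≤ HatH)
  (cuspMeetsH : {x : X.Pt // X.IsCusp x} → Prop)

/-- **Thm. 3.7 (iii) at every level fibre from the finiteness record** (`compactInVerticialAt_of_finiteGraph'`).
[cite: MochizukiSemiAnbd2006, Thm 3.7(iii) p.41] -/
theorem compactInVerticialAt_levels_of_finiteLevels (hF : SpecialFibreTower.FiniteLevels X d S T) (i : ℕ) :
    CompactInVerticialAt (T.Gc i) :=
  compactInVerticialAt_of_finiteGraph' (hF.finite_vertex i) (hF.finite_edge i)

/-- **[IUTchI] Prop. 2.4 (i) AS TYPED at the genuine 𝔛-data, FINITE fibres**: as `prop24i_ofSpecialFibre_byName`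
with the per-level Thm. 3.7 (iii) binders DISCHARGED from `FiniteLevels`; named inputs left: `hcof`, the level node
data with (A3), `StronglyTorsionFreeSigma`, `SpecializationAb`, `DetectsTempered`.
[cite: Mochizuki2012, Prop 2.4(i) p.50] -/
theorem prop24i_ofSpecialFibre_of_finiteLevels (hF : SpecialFibreTower.FiniteLevels X d S T)
    (hcof : ∀ U : Subgroup X.DeltaTemp, IsOpen (U : Set X.DeltaTemp) → U.Normal → U.FiniteIndex →
      ∃ i, T.N i ≤ U)
    (hstf : (ofSpecialFibre X d S h36 Sigma SigmaHat hsub hne hprime hp TpH HatH hle cuspMeetsH).StronglyTorsionFreeSigma)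
    (Λv : ∀ i, (T.Gc i).graph.Vertex → Subgroup (T.chart i).G)
    (hΛv : ∀ i v, Λv i v ∈ verticialSubgroups (T.chart i) v)
    (E : ℕ → Type) (src tgt : ∀ i, E i → (T.Gc i).graph.Vertex) (c₁ c₂ : ∀ i, E i → (T.chart i).G)
    (hA3 : ∀ i (v w : (T.Gc i).graph.Vertex) (g h : (levelGraph X T Sigma SigmaHat hsub hne hprime i).Hat),
      MulAut.conj g • (Λv i v).map (levelGraph X T Sigma SigmaHat hsub hne hprime i).ι ⊓
          MulAut.conj h • (Λv i w).map (levelGraph X T Sigma SigmaHat hsub hne hprime i).ι ≠ ⊥ →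
        (v = w ∧ g⁻¹ * h ∈ (Λv i v).map (levelGraph X T Sigma SigmaHat hsub hne hprime i).ι) ∨
        ∃ (e : E i) (k : (levelGraph X T Sigma SigmaHat hsub hne hprime i).Hat),
          ∃ p ∈ (Λv i (src i e)).map (levelGraph X T Sigma SigmaHat hsub hne hprime i).ι,
          ∃ q ∈ (Λv i (tgt i e)).map (levelGraph X T Sigma SigmaHat hsub hne hprime i).ι,
            (src i e = v ∧ tgt i e = w ∧
                g = k * (levelGraph X T Sigma SigmaHat hsub hne hprime i).ι (c₁ i e) * p ∧
                h = k * (levelGraph X T Sigma SigmaHat hsub hne hprime i).ι (c₂ i e) * q) ∨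
            (src i e = w ∧ tgt i e = v ∧
                h = k * (levelGraph X T Sigma SigmaHat hsub hne hprime i).ι (c₁ i e) * p ∧
                g = k * (levelGraph X T Sigma SigmaHat hsub hne hprime i).ι (c₂ i e) * q))
    (hspec : (towerOfSpecialFibreTower X d T Sigma SigmaHat hsub hne hprime S h36 hp TpH HatH hle cuspMeetsH).SpecializationAb)
    (hINV : (towerOfSpecialFibreTower X d T Sigma SigmaHat hsub hne hprime S h36 hp TpH HatH hle cuspMeetsH).DetectsTempered) :
    (ofSpecialFibre X d S h36 Sigma SigmaHat hsub hne hprime hp TpH HatH hle cuspMeetsH).Prop24i :=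
  prop24i_ofSpecialFibre_byName X d T Sigma SigmaHat hsub hne hprime S h36 hp TpH HatH hle cuspMeetsH hcof hstf
    (compactInVerticialAt_levels_of_finiteLevels X d T S hF) Λv hΛv E src tgt c₁ c₂ hA3 hspec hINV

/-- **[IUTchI] Prop. 2.4 (i) AS TYPED at the genuine 𝔛-data over the `Π`-data record** `P : SpecialFibreTower.PiData`
(abc-iut-L3-t2): `hcof := P.N_cofinal` (G-L5t11g6-1 closed) and Thm. 3.7 (iii) at the finite fibres from `P.finite`;
named inputs left: the level node data with (A3), `StronglyTorsionFreeSigma`, `SpecializationAb`, `DetectsTempered`.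
[cite: Mochizuki2012, Prop 2.4(i) p.50] -/
theorem prop24i_ofSpecialFibre_of_piData (P : SpecialFibreTower.PiData X d S T)
    (hstf : (ofSpecialFibre X d S h36 Sigma SigmaHat hsub hne hprime hp TpH HatH hle cuspMeetsH).StronglyTorsionFreeSigma)
    (Λv : ∀ i, (T.Gc i).graph.Vertex → Subgroup (T.chart i).G)
    (hΛv : ∀ i v, Λv i v ∈ verticialSubgroups (T.chart i) v)
    (E : ℕ → Type) (src tgt : ∀ i, E i → (T.Gc i).graph.Vertex) (c₁ c₂ : ∀ i, E i → (T.chart i).G)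
    (hA3 : ∀ i (v w : (T.Gc i).graph.Vertex) (g h : (levelGraph X T Sigma SigmaHat hsub hne hprime i).Hat),
      MulAut.conj g • (Λv i v).map (levelGraph X T Sigma SigmaHat hsub hne hprime i).ι ⊓
          MulAut.conj h • (Λv i w).map (levelGraph X T Sigma SigmaHat hsub hne hprime i).ι ≠ ⊥ →
        (v = w ∧ g⁻¹ * h ∈ (Λv i v).map (levelGraph X T Sigma SigmaHat hsub hne hprime i).ι) ∨
        ∃ (e : E i) (k : (levelGraph X T Sigma SigmaHat hsub hne hprime i).Hat),
          ∃ p ∈ (Λv i (src i e)).map (levelGraph X T Sigma SigmaHat hsub hne hprime i).ι,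
          ∃ q ∈ (Λv i (tgt i e)).map (levelGraph X T Sigma SigmaHat hsub hne hprime i).ι,
            (src i e = v ∧ tgt i e = w ∧
                g = k * (levelGraph X T Sigma SigmaHat hsub hne hprime i).ι (c₁ i e) * p ∧
                h = k * (levelGraph X T Sigma SigmaHat hsub hne hprime i).ι (c₂ i e) * q) ∨
            (src i e = w ∧ tgt i e = v ∧
                h = k * (levelGraph X T Sigma SigmaHat hsub hne hprime i).ι (c₁ i e) * p ∧
                g = k * (levelGraph X T Sigma SigmaHat hsub hne hprime i).ι (c₂ i e) * q))
    (hspec : (towerOfSpecialFibreTower X d T Sigma SigmaHat hsub hne hprime S h36 hp TpH HatH hle cuspMeetsH).SpecializationAb)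
    (hINV : (towerOfSpecialFibreTower X d T Sigma SigmaHat hsub hne hprime S h36 hp TpH HatH hle cuspMeetsH).DetectsTempered) :
    (ofSpecialFibre X d S h36 Sigma SigmaHat hsub hne hprime hp TpH HatH hle cuspMeetsH).Prop24i :=
  prop24i_ofSpecialFibre_of_finiteLevels X d T Sigma SigmaHat hsub hne hprime S h36 hp TpH HatH hle cuspMeetsH
    P.finite P.N_cofinal hstf Λv hΛv E src tgt c₁ c₂ hA3 hspec hINV

end OfSpecialFibre

end StableCurveTemperedData

end Literature.IUT.HodgeTheaters

end
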